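import Summits.SmoothPoincare4.SmoothPoincare4.Theorems.SymplecticOrigamiGromovRecognitionRelEndZeroCountStable
import Summits.SmoothPoincare4.SmoothPoincare4.Theorems.SymplecticOrigamiGromovRecognitionRelEndMeromorphicOrderCompInv

/-!
# Two-chart zero counting at a fixed parameter: squares, near/far decomposition
(registered helper `helper_twoChartFarZeroCount`, auxiliary to the registered helper
`helper_sphereWedgeCountStable` of line `cross-cap-laurent`, crux `GromovRecognitionRelEnd`,
item stmt-SmoothPoincare4-11009)

Static pieces of the proof that the intersection count of a continuous family of two-chart
`JX`-spheres with a sphere at infinity is locally constant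
(`SymplecticOrigamiGromovRecognitionRelEndSphereWedgeCountStable`), phrased for families
`f g : S → ℂ → ℂ` with domains `D, E ⊆ S × ℂ` related by the chart change `g s w = f s w⁻¹`,
`(s, w) ∈ E ↔ (s, w⁻¹) ∈ D` (`w ≠ 0`), at a FIXED parameter `s`:

* squares `[c.re ± δ] × [c.im ± δ]` and `[-r, r]²` versus discs;
* `zeroCount_near_decomp`: the zeros of `f s` in its domain split into those in small pairwise
  disjoint open squares around prescribed points and those outside their union `I`;
* `helper_twoChartFarZeroCount` (registered): if `f s` has no zero `z` with `‖z‖ ≤ r⁻¹` outside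
  `I ⊆ {‖w‖ < M}` (`2rM < 1`) and `g s` is zero-free on the boundary of the square `[-r, r]²`
  contained in its domain, then the zeros of `f s` outside `I` correspond under `z ↦ z⁻¹`, with
  the same multiplicity (`helper_meromorphicOrderAt_comp_inv`), to the zeros `w ≠ 0` of `g s` in
  `(-r, r)²`, so that their total multiplicity plus the multiplicity of `g s` at `w = 0` is the
  zero count of `g s` in `(-r, r)²`; `zeroCount_far_decomp_off`: if instead `[-r, r]²` carries
  no zero of `g s` in its domain, there are no zeros of `f s` outside `I` and none at `w = 0`;
* the choice of the sizes `δ`, `r` of the squares (`exists_halfSide_squares`,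
  `exists_halfSide_inftySquare`).

References: the argument principle / Hurwitz's theorem (folklore complex analysis;
`Literature.Analysis.Complex.ArgumentPrincipleRectangle`); D. McDuff, D. Salamon, *J-holomorphic
Curves and Symplectic Topology*, 2nd ed. (2012), §2.6 and Appendix E (local intersection numbers
of `J`-holomorphic curves). No definitions, notation or instances.
-/

noncomputable section

open Complex Set Filter Topology Metric

-- the prescribed namespace `Summit.<P>.<Sub>.…` duplicates `SmoothPoincare4` (P = Sub)
set_option linter.dupNamespace false

namespace Summit.SmoothPoincare4.SmoothPoincare4.Theorems.GromovRecognitionRelEnd.CrossCapLaurent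

/-! ## Squares versus discs -/

/-- The closed square of half-side `δ` centred at `c` lies in the closed disc of radius `2δ`
about `c` (`‖w‖ ≤ |re w| + |im w|`). -/
theorem closedSquare_subset_closedBall_two_mul {c : ℂ} {δ : ℝ} :
    Icc (c.re - δ) (c.re + δ) ×ℂ Icc (c.im - δ) (c.im + δ) ⊆ closedBall c (2 * δ) := by
  intro w hw
  rw [mem_reProdIm, mem_Icc, mem_Icc] at hw
  rw [mem_closedBall, dist_eq_norm]
  have h1 : |(w - c).re| ≤ δ := by rw [sub_re]; exact abs_sub_le_iff.2 ⟨by linarith, by linarith⟩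
  have h2 : |(w - c).im| ≤ δ := by rw [sub_im]; exact abs_sub_le_iff.2 ⟨by linarith, by linarith⟩
  linarith [norm_le_abs_re_add_abs_im (w - c)]

/-- The open disc of radius `δ` about `c` lies in the open square of half-side `δ` centred at `c`
(`|re w|, |im w| ≤ ‖w‖`). -/
theorem ball_subset_openSquare {c : ℂ} {δ : ℝ} :
    ball c δ ⊆ Ioo (c.re - δ) (c.re + δ) ×ℂ Ioo (c.im - δ) (c.im + δ) := by
  intro w hw
  rw [mem_ball, dist_eq_norm] at hw
  have h1 := abs_re_le_norm (w - c)
  have h2 := abs_im_le_norm (w - c)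
  rw [sub_re] at h1
  rw [sub_im] at h2
  obtain ⟨h1a, h1b⟩ := abs_sub_lt_iff.1 (lt_of_le_of_lt h1 hw)
  obtain ⟨h2a, h2b⟩ := abs_sub_lt_iff.1 (lt_of_le_of_lt h2 hw)
  exact ⟨⟨by linarith, by linarith⟩, ⟨by linarith, by linarith⟩⟩

/-- The centre belongs to its open square of positive half-side. -/
theorem self_mem_openSquare {c : ℂ} {δ : ℝ} (hδ : 0 < δ) :
    c ∈ Ioo (c.re - δ) (c.re + δ) ×ℂ Ioo (c.im - δ) (c.im + δ) :=
  ball_subset_openSquare (mem_ball_self hδ)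

/-- An open rectangle lies in the closed rectangle with the same sides. -/
theorem Ioo_reProdIm_Ioo_subset_Icc {a b c d : ℝ} : Ioo a b ×ℂ Ioo c d ⊆ Icc a b ×ℂ Icc c d :=
  fun _ hw => ⟨Ioo_subset_Icc_self hw.1, Ioo_subset_Icc_self hw.2⟩

/-- The closed square `[-r, r]²` lies in the closed disc of radius `2r` about `0`. -/
theorem closedSquare_zero_subset_closedBall {r : ℝ} :
    Icc (-r) r ×ℂ Icc (-r) r ⊆ closedBall (0 : ℂ) (2 * r) := by
  have h := closedSquare_subset_closedBall_two_mul (c := 0) (δ := r)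
  simpa only [zero_re, zero_im, zero_sub, zero_add] using h

/-- The open disc of radius `r` about `0` lies in the open square `(-r, r)²`. -/
theorem ball_zero_subset_openSquare {r : ℝ} : ball (0 : ℂ) r ⊆ Ioo (-r) r ×ℂ Ioo (-r) r := by
  have h := ball_subset_openSquare (c := 0) (δ := r)
  simpa only [zero_re, zero_im, zero_sub, zero_add] using h

/-- `0` lies in the open square `(-r, r)²` for `r > 0`. -/
theorem zero_mem_openSquare {r : ℝ} (hr : 0 < r) : (0 : ℂ) ∈ Ioo (-r) r ×ℂ Ioo (-r) r :=
  ball_zero_subset_openSquare (mem_ball_self hr)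

/-- If `‖w‖ ≤ 2r`, `w ≠ 0` and `2rM < 1` (`M > 0`), then `M < ‖w⁻¹‖`. -/
theorem lt_norm_inv_of_norm_le_two_mul {w : ℂ} {r M : ℝ} (hM : 0 < M) (hrM : 2 * r * M < 1)
    (hw : ‖w‖ ≤ 2 * r) (hw0 : w ≠ 0) : M < ‖w⁻¹‖ := by
  have hpos : 0 < ‖w‖ := norm_pos_iff.2 hw0
  have h1 : ‖w‖ * ‖w⁻¹‖ = 1 := by rw [norm_inv, mul_inv_cancel₀ hpos.ne']
  by_contra hle
  push Not at hle
  nlinarith [mul_le_mul_of_nonneg_left hle hpos.le, mul_le_mul_of_nonneg_right hw hM.le]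

/-! ## The count at a fixed parameter -/

/-- **Near part of the count.** Fix a parameter `s`. Suppose the closed squares of half-side
`δ` around the points of a finite set `Z₀` lie in the slice `D_s`, `f s` (analytic on the slice)
has no zero on their boundaries, the open squares are pairwise disjoint, and the zeros of `f s`
in `D_s` outside the open squares form a finite set. Then the zero set of `f s` in `D_s` is finite
and its total multiplicity splits as the sum over `z ∈ Z₀` of the multiplicities inside the open
square around `z`, plus the total multiplicity outside the squares. -/
theorem zeroCount_near_decomp {S : Type} {f : S → ℂ → ℂ} {D : Set (S × ℂ)} {s : S} {Z₀ : Set ℂ}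
    (hZ₀ : Z₀.Finite) {δ : ℝ} (hδ : 0 < δ)
    (hK : ∀ z ∈ Z₀, ∀ w ∈ Icc (z.re - δ) (z.re + δ) ×ℂ Icc (z.im - δ) (z.im + δ), (s, w) ∈ D)
    (han : ∀ w, (s, w) ∈ D → AnalyticAt ℂ (f s) w)
    (hbd : ∀ z ∈ Z₀, ∀ w ∈ Icc (z.re - δ) (z.re + δ) ×ℂ Icc (z.im - δ) (z.im + δ),
      w ∉ Ioo (z.re - δ) (z.re + δ) ×ℂ Ioo (z.im - δ) (z.im + δ) → f s w ≠ 0)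
    (hdisj : Z₀.PairwiseDisjoint fun z => Ioo (z.re - δ) (z.re + δ) ×ℂ Ioo (z.im - δ) (z.im + δ))
    (hfar : ({z : ℂ | (s, z) ∈ D ∧ f s z = 0} \
      ⋃ z ∈ Z₀, Ioo (z.re - δ) (z.re + δ) ×ℂ Ioo (z.im - δ) (z.im + δ)).Finite) :
    {z : ℂ | (s, z) ∈ D ∧ f s z = 0}.Finite ∧
    ∑ᶠ z ∈ {z : ℂ | (s, z) ∈ D ∧ f s z = 0}, (meromorphicOrderAt (f s) z).untop₀ =
      (∑ᶠ z ∈ Z₀, ∑ᶠ w ∈ {w : ℂ | f s w = 0 ∧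
          w ∈ Ioo (z.re - δ) (z.re + δ) ×ℂ Ioo (z.im - δ) (z.im + δ)},
          (meromorphicOrderAt (f s) w).untop₀) +
      ∑ᶠ z ∈ {z : ℂ | (s, z) ∈ D ∧ f s z = 0} \
          ⋃ z ∈ Z₀, Ioo (z.re - δ) (z.re + δ) ×ℂ Ioo (z.im - δ) (z.im + δ),
        (meromorphicOrderAt (f s) z).untop₀ := by
  set Z : Set ℂ := {z : ℂ | (s, z) ∈ D ∧ f s z = 0} with hZ_def
  set I : Set ℂ := ⋃ z ∈ Z₀, Ioo (z.re - δ) (z.re + δ) ×ℂ Ioo (z.im - δ) (z.im + δ) with hI_def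
  -- the zeros in each open square
  have hsq : ∀ z ∈ Z₀, Z ∩ (Ioo (z.re - δ) (z.re + δ) ×ℂ Ioo (z.im - δ) (z.im + δ)) =
      {w : ℂ | f s w = 0 ∧ w ∈ Ioo (z.re - δ) (z.re + δ) ×ℂ Ioo (z.im - δ) (z.im + δ)} := by
    intro z hz
    ext w
    simp only [mem_inter_iff, hZ_def, mem_setOf_eq]
    exact ⟨fun h => ⟨h.1.2, h.2⟩,
      fun h => ⟨⟨hK z hz w (Ioo_reProdIm_Ioo_subset_Icc h.2), h.1⟩, h.2⟩⟩
  have hfin_sq : ∀ z ∈ Z₀, {w : ℂ | f s w = 0 ∧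
      w ∈ Ioo (z.re - δ) (z.re + δ) ×ℂ Ioo (z.im - δ) (z.im + δ)}.Finite := by
    intro z hz
    have hab : z.re - δ ≤ z.re + δ := by linarith
    have hcd : z.im - δ ≤ z.im + δ := by linarith
    have hb := bot_edge_mem (a := z.re - δ) (b := z.re + δ) hcd ⟨le_rfl, hab⟩
    exact Literature.Analysis.Complex.finite_zeros_reProdIm hab hcd
      (fun w hw => han w (hK z hz w hw)) hb.1 (hbd z hz _ hb.1 hb.2)
  have hZI : Z ∩ I = ⋃ z ∈ Z₀, (Z ∩ (Ioo (z.re - δ) (z.re + δ) ×ℂ Ioo (z.im - δ) (z.im + δ))) := by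
    rw [hI_def, inter_iUnion₂]
  have hfinZI : (Z ∩ I).Finite := by
    rw [hZI]
    exact hZ₀.biUnion fun z hz => by rw [hsq z hz]; exact hfin_sq z hz
  have hfinZ : Z.Finite := by
    rw [← inter_union_sdiff Z I]
    exact hfinZI.union hfar
  refine ⟨hfinZ, ?_⟩
  have hdisj' : Z₀.PairwiseDisjoint fun z =>
      Z ∩ (Ioo (z.re - δ) (z.re + δ) ×ℂ Ioo (z.im - δ) (z.im + δ)) :=
    hdisj.mono_on fun z _ => inter_subset_right
  rw [← finsum_mem_inter_add_sdiff I hfinZ, hZI,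
    finsum_mem_biUnion hdisj' hZ₀ fun z hz => by rw [hsq z hz]; exact hfin_sq z hz]
  congr 1
  exact finsum_mem_congr rfl fun z hz => finsum_mem_congr (hsq z hz) fun _ _ => rfl

/-- **Far part of the two-chart zero count** (registered helper). Fix a parameter `s` of families
`f g : S → ℂ → ℂ` with domains `D, E ⊆ S × ℂ` related by the chart change `w = z⁻¹`
(`(s, w) ∈ E ↔ (s, w⁻¹) ∈ D`, `g s w = f s w⁻¹` for `w ≠ 0`), analytic on their slices.  Let
`0 < r`, `0 < M`, `2rM < 1`, let `I ⊆ {‖w‖ < M}`, suppose the closed square `[-r, r]²` lies in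
the slice `E_s` with `g s ≠ 0` on its boundary, and suppose `f s` has no zero `z ∈ D_s` with
`‖z‖ ≤ r⁻¹` outside `I`.  Then the zeros of `f s` in `D_s` outside `I` form a finite set, and
their total multiplicity plus the multiplicity of `g s` at `w = 0` (if `0` is a zero of `g s` in
`E_s`) equals the total multiplicity of the zeros of `g s` in the open square `(-r, r)²`: the far
zeros `z` correspond bijectively to the zeros `w = z⁻¹ ≠ 0` of `g s` in the square, with the same
multiplicity (`helper_meromorphicOrderAt_comp_inv`). [folklore] -/
theorem helper_twoChartFarZeroCount : ∀ (S : Type) (f g : S → ℂ → ℂ) (D E : Set (S × ℂ)) (s : S) (I : Set ℂ) (r M : ℝ), 0 < r → 0 < M → 2 * r * M < 1 → (∀ w : ℂ, w ≠ 0 → ((s, w) ∈ E ↔ (s, w⁻¹) ∈ D)) → (∀ w : ℂ, w ≠ 0 → g s w = f s w⁻¹) → (∀ w : ℂ, (s, w) ∈ D → AnalyticAt ℂ (f s) w) → (∀ w : ℂ, (s, w) ∈ E → AnalyticAt ℂ (g s) w) → (∀ w ∈ I, ‖w‖ < M) → (∀ w ∈ Set.Icc (-r) r ×ℂ Set.Icc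 (-r) r, (s, w) ∈ E) → (∀ w ∈ Set.Icc (-r) r ×ℂ Set.Icc (-r) r, w ∉ Set.Ioo (-r) r ×ℂ Set.Ioo (-r) r → g s w ≠ 0) → (∀ w : ℂ, ‖w‖ ≤ r⁻¹ → w ∉ I → ¬ ((s, w) ∈ D ∧ f s w = 0)) → ({z : ℂ | (s, z) ∈ D ∧ f s z = 0} \ I).Finite ∧ (∑ᶠ z ∈ {z : ℂ | (s, z) ∈ D ∧ f s z = 0} \ I, (meromorphicOrderAt (f s) z).untop₀) + (∑ᶠ w ∈ {w : ℂ | w = 0 ∧ (s, w) ∈ E ∧ g s w = 0}, (meromorphicOrderAt (g s) w).untop₀) = ∑ᶠ w ∈ {w : ℂ | g s w = 0 ∧ w ∈ Set.Ioo (-r) r ×ℂ Set.Ioo (-r) r}, (meromorphicOrderAt (g s) w).untop₀ := by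
  intro S f g D E s I r M hr hM hrM hED hgf han hgan hI hK hbd hQ
  set Z : Set ℂ := {z : ℂ | (s, z) ∈ D ∧ f s z = 0} with hZ_def
  set G : Set ℂ := {w : ℂ | g s w = 0 ∧ w ∈ Ioo (-r) r ×ℂ Ioo (-r) r} with hG_def
  have hrr : -r ≤ r := by linarith
  -- finiteness of the zeros of `g s` in the open square
  have hGfin : G.Finite := by
    have hb := bot_edge_mem (a := -r) (b := r) hrr ⟨le_rfl, hrr⟩
    exact Literature.Analysis.Complex.finite_zeros_reProdIm hrr hrr
      (fun w hw => hgan w (hK w hw)) hb.1 (hbd _ hb.1 hb.2)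
  -- the zero at the origin
  have hG0 : G ∩ {0} = {w : ℂ | w = 0 ∧ (s, w) ∈ E ∧ g s w = 0} := by
    ext w
    simp only [mem_inter_iff, mem_singleton_iff, hG_def, mem_setOf_eq]
    constructor
    · rintro ⟨⟨hgw, hw⟩, rfl⟩
      exact ⟨rfl, hK 0 (Ioo_reProdIm_Ioo_subset_Icc hw), hgw⟩
    · rintro ⟨rfl, -, hgw⟩
      exact ⟨⟨hgw, zero_mem_openSquare hr⟩, rfl⟩
  -- the bijection `z ↦ z⁻¹` between far zeros of `f s` and non-zero zeros of `g s` in the square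
  have hfarnorm : ∀ z ∈ Z \ I, r⁻¹ < ‖z‖ := fun z hz =>
    lt_of_not_ge fun hle => hQ z hle hz.2 hz.1
  have hmaps1 : MapsTo (fun z : ℂ => z⁻¹) (Z \ I) (G \ {0}) := by
    intro z hz
    have hzn := hfarnorm z hz
    have hz0 : z ≠ 0 := norm_pos_iff.1 (lt_trans (inv_pos.2 hr) hzn)
    refine ⟨⟨?_, ball_zero_subset_openSquare ?_⟩, inv_ne_zero hz0⟩
    · rw [hgf _ (inv_ne_zero hz0), inv_inv]
      exact hz.1.2
    · rw [mem_ball, dist_zero_right, norm_inv]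
      exact inv_lt_of_inv_lt₀ hr hzn
  have hmaps2 : MapsTo (fun w : ℂ => w⁻¹) (G \ {0}) (Z \ I) := by
    intro w hw
    have hw0 : w ≠ 0 := hw.2
    have hwK := Ioo_reProdIm_Ioo_subset_Icc hw.1.2
    refine ⟨⟨(hED w hw0).1 (hK w hwK), ?_⟩, fun hwI => ?_⟩
    · rw [← hgf w hw0]
      exact hw.1.1
    · have h2r : ‖w‖ ≤ 2 * r := by
        have := closedSquare_zero_subset_closedBall hwK
        rwa [mem_closedBall, dist_zero_right] at this
      exact (lt_irrefl M)
        (lt_trans (lt_norm_inv_of_norm_le_two_mul hM hrM h2r hw0) (hI _ hwI))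
  have hinv : InvOn (fun w : ℂ => w⁻¹) (fun z : ℂ => z⁻¹) (Z \ I) (G \ {0}) :=
    ⟨fun z _ => inv_inv z, fun w _ => inv_inv w⟩
  have hbij1 : BijOn (fun z : ℂ => z⁻¹) (Z \ I) (G \ {0}) := hinv.bijOn hmaps1 hmaps2
  have hbij2 : BijOn (fun w : ℂ => w⁻¹) (G \ {0}) (Z \ I) := hinv.symm.bijOn hmaps2 hmaps1
  have hfarfin : (Z \ I).Finite := by
    rw [← hbij2.image_eq]
    exact hGfin.sdiff.image _
  refine ⟨hfarfin, ?_⟩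
  -- equality of multiplicities under the chart change
  have hsum : ∑ᶠ z ∈ Z \ I, (meromorphicOrderAt (f s) z).untop₀ =
      ∑ᶠ w ∈ G \ {0}, (meromorphicOrderAt (g s) w).untop₀ := by
    refine finsum_mem_eq_of_bijOn (fun z : ℂ => z⁻¹) hbij1 fun z hz => ?_
    have hzn := hfarnorm z hz
    have hz0 : z ≠ 0 := norm_pos_iff.1 (lt_trans (inv_pos.2 hr) hzn)
    have heq : g s =ᶠ[𝓝 z⁻¹] fun w => f s w⁻¹ := by
      filter_upwards [eventually_ne_nhds (inv_ne_zero hz0)] with w hw using hgf w hw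
    show (meromorphicOrderAt (f s) z).untop₀ = (meromorphicOrderAt (g s) z⁻¹).untop₀
    rw [meromorphicOrderAt_congr (heq.filter_mono nhdsWithin_le_nhds),
      helper_meromorphicOrderAt_comp_inv (f s) z⁻¹ (inv_ne_zero hz0)
        (by rw [inv_inv]; exact han z hz.1.1), inv_inv]
  rw [hsum, ← hG0, add_comm, finsum_mem_inter_add_sdiff _ hGfin]

/-- **Far part of the count, case B** (the point at infinity is off the divisor). Fix `s`. If no
point of the closed square `[-r, r]²` is a zero of `g s` in `E_s`, and `f s` has no zero
`z ∈ D_s` with `‖z‖ ≤ r⁻¹` outside `I`, then `f s` has no zero in `D_s` outside `I` at all, and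
`0` is not a zero of `g s` in `E_s`. -/
theorem zeroCount_far_decomp_off {S : Type} {f g : S → ℂ → ℂ} {D E : Set (S × ℂ)} {s : S}
    {I : Set ℂ} {r : ℝ} (hr : 0 < r)
    (hED : ∀ w : ℂ, w ≠ 0 → ((s, w) ∈ E ↔ (s, w⁻¹) ∈ D))
    (hgf : ∀ w : ℂ, w ≠ 0 → g s w = f s w⁻¹)
    (hK : ∀ w ∈ Icc (-r) r ×ℂ Icc (-r) r, ¬ ((s, w) ∈ E ∧ g s w = 0))
    (hQ : ∀ w : ℂ, ‖w‖ ≤ r⁻¹ → w ∉ I → ¬ ((s, w) ∈ D ∧ f s w = 0)) :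
    {z : ℂ | (s, z) ∈ D ∧ f s z = 0} \ I = ∅ ∧ {w : ℂ | w = 0 ∧ (s, w) ∈ E ∧ g s w = 0} = ∅ := by
  constructor
  · rw [eq_empty_iff_forall_notMem]
    intro z hz
    have hzn : r⁻¹ < ‖z‖ := lt_of_not_ge fun hle => hQ z hle hz.2 hz.1
    have hz0 : z ≠ 0 := norm_pos_iff.1 (lt_trans (inv_pos.2 hr) hzn)
    have hmem : z⁻¹ ∈ Ioo (-r) r ×ℂ Ioo (-r) r := by
      refine ball_zero_subset_openSquare ?_
      rw [mem_ball, dist_zero_right, norm_inv]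
      exact inv_lt_of_inv_lt₀ hr hzn
    refine hK z⁻¹ (Ioo_reProdIm_Ioo_subset_Icc hmem) ⟨(hED _ (inv_ne_zero hz0)).2 ?_, ?_⟩
    · rw [inv_inv]; exact hz.1.1
    · rw [hgf _ (inv_ne_zero hz0), inv_inv]; exact hz.1.2
  · rw [eq_empty_iff_forall_notMem]
    rintro w ⟨rfl, hE, hg⟩
    exact hK 0 (Ioo_reProdIm_Ioo_subset_Icc (zero_mem_openSquare hr)) ⟨hE, hg⟩

/-! ## Choice of the sizes of the squares -/

/-- **Size of the squares around the finitely many zeros.** For a finite subset `Z₀` of an open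
set `O ⊆ ℂ` there is `δ ∈ (0, 1]` such that the closed discs of radius `2δ` about the points of
`Z₀` lie in `O` and distinct points of `Z₀` are more than `4δ` apart. -/
theorem exists_halfSide_squares {O Z₀ : Set ℂ} (hO : IsOpen O) (hZ₀ : Z₀.Finite) (hZO : Z₀ ⊆ O) :
    ∃ δ : ℝ, 0 < δ ∧ δ ≤ 1 ∧ (∀ z ∈ Z₀, closedBall z (2 * δ) ⊆ O) ∧
      ∀ z ∈ Z₀, ∀ z' ∈ Z₀, z' ≠ z → 4 * δ < dist z' z := by
  have h1 : ∀ᶠ δ in 𝓝[>] (0 : ℝ), 0 < δ := eventually_mem_nhdsWithin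
  have h2 : ∀ᶠ δ in 𝓝[>] (0 : ℝ), δ ≤ 1 :=
    (eventually_le_nhds one_pos).filter_mono nhdsWithin_le_nhds
  have h3 : ∀ᶠ δ in 𝓝[>] (0 : ℝ), ∀ z ∈ Z₀, closedBall z (2 * δ) ⊆ O := by
    refine hZ₀.eventually_all.2 fun z hz => ?_
    obtain ⟨ε, hε, hεO⟩ := nhds_basis_closedBall.mem_iff.1 (hO.mem_nhds (hZO hz))
    have : ∀ᶠ δ in 𝓝 (0 : ℝ), δ < ε / 2 := eventually_lt_nhds (by linarith)
    filter_upwards [this.filter_mono nhdsWithin_le_nhds] with δ hδ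
    exact (closedBall_subset_closedBall (by linarith)).trans hεO
  have h4 : ∀ᶠ δ in 𝓝[>] (0 : ℝ), ∀ z ∈ Z₀, ∀ z' ∈ Z₀, z' ≠ z → 4 * δ < dist z' z := by
    refine hZ₀.eventually_all.2 fun z _ => hZ₀.eventually_all.2 fun z' _ => ?_
    by_cases hne : z' = z
    · exact Eventually.of_forall fun δ h => absurd hne h
    · have hd : 0 < dist z' z := dist_pos.2 hne
      have : ∀ᶠ δ in 𝓝 (0 : ℝ), δ < dist z' z / 4 := eventually_lt_nhds (by linarith)
      filter_upwards [this.filter_mono nhdsWithin_le_nhds] with δ hδ _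
      linarith
  obtain ⟨δ, hδ, hδ1, hδO, hδsep⟩ := (h1.and (h2.and (h3.and h4))).exists
  exact ⟨δ, hδ, hδ1, hδO, hδsep⟩

/-- **Size of the square around the point at infinity.** Given an open `P ⊆ ℂ`, a closed
`B₀ ⊆ P` and `M > 0`, there is `r > 0` with `2rM < 1` such that the closed disc of radius `2r`
about `0` lies in `P` if `0 ∈ B₀`, and misses `B₀` if `0 ∉ B₀`. -/
theorem exists_halfSide_inftySquare {P B₀ : Set ℂ} (hP : IsOpen P) (hB : IsClosed B₀)
    (hBP : B₀ ⊆ P) {M : ℝ} (hM : 0 < M) :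
    ∃ r : ℝ, 0 < r ∧ 2 * r * M < 1 ∧ ((0 : ℂ) ∈ B₀ → closedBall (0 : ℂ) (2 * r) ⊆ P) ∧
      ((0 : ℂ) ∉ B₀ → ∀ w ∈ closedBall (0 : ℂ) (2 * r), w ∉ B₀) := by
  have h1 : ∀ᶠ r in 𝓝[>] (0 : ℝ), 0 < r := eventually_mem_nhdsWithin
  have h2 : ∀ᶠ r in 𝓝[>] (0 : ℝ), 2 * r * M < 1 := by
    have : ∀ᶠ r in 𝓝 (0 : ℝ), r < 1 / (2 * M) := eventually_lt_nhds (by positivity)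
    filter_upwards [this.filter_mono nhdsWithin_le_nhds] with r hr
    have h := (lt_div_iff₀ (by positivity : (0 : ℝ) < 2 * M)).1 hr
    calc 2 * r * M = r * (2 * M) := by ring
      _ < 1 := h
  have h3 : ∀ᶠ r in 𝓝[>] (0 : ℝ), ((0 : ℂ) ∈ B₀ → closedBall (0 : ℂ) (2 * r) ⊆ P) := by
    by_cases h0 : (0 : ℂ) ∈ B₀
    · obtain ⟨ε, hε, hεP⟩ := nhds_basis_closedBall.mem_iff.1 (hP.mem_nhds (hBP h0))
      have : ∀ᶠ r in 𝓝 (0 : ℝ), r < ε / 2 := eventually_lt_nhds (by linarith)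
      filter_upwards [this.filter_mono nhdsWithin_le_nhds] with r hr _
      exact (closedBall_subset_closedBall (by linarith)).trans hεP
    · exact Eventually.of_forall fun r h => absurd h h0
  have h4 : ∀ᶠ r in 𝓝[>] (0 : ℝ),
      ((0 : ℂ) ∉ B₀ → ∀ w ∈ closedBall (0 : ℂ) (2 * r), w ∉ B₀) := by
    by_cases h0 : (0 : ℂ) ∈ B₀
    · exact Eventually.of_forall fun r h => absurd h0 h
    · obtain ⟨ε, hε, hεB⟩ := nhds_basis_closedBall.mem_iff.1 (hB.isOpen_compl.mem_nhds h0)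
      have : ∀ᶠ r in 𝓝 (0 : ℝ), r < ε / 2 := eventually_lt_nhds (by linarith)
      filter_upwards [this.filter_mono nhdsWithin_le_nhds] with r hr _ w hw
      exact hεB (closedBall_subset_closedBall (by linarith) hw)
  obtain ⟨r, hr, hrM, hrA, hrB⟩ := (h1.and (h2.and (h3.and h4))).exists
  exact ⟨r, hr, hrM, hrA, hrB⟩

end Summit.SmoothPoincare4.SmoothPoincare4.Theorems.GromovRecognitionRelEnd.CrossCapLaurent

end
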